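import Summits.QuantumAdvantage.AdviceFreeQNC0.AffBells26CubeTargetGen
import Summits.QuantumAdvantage.AdviceFreeQNC0.AffBells26TargetFormula
import HarnessLib

/-!
# A mismatching move cube contains a lost input (planner qn-p1 g27, ROUND-26 §4, first step of the windowed double count `DensityUpgradeWin`)

Prover seat qn-prover-3 g14.  **`exists_lost_of_mismatch`**: if `(x, F, O)` is a move system with `m ≥ 2` moves (`N ≥ 5`) and the cube
MISMATCHES for `(β, c)` (`AffBells26.Mismatch`: survivors' sum and target sum have different parities), then some cube point `x_S` is an
odd input on which the affine bell strategy `(β, c)` loses.  Unconditional: Q1-gen `cubeIdentityGen` and Q0 `targetFormula` are tree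
theorems.  (This is the semantic content of every sieve certificate — creation cubes, hops, windows — and the map "certificate ↦ lost
point" that the double count of `DensityUpgradeWin` integrates.)  Also `exists_lost_of_cubeRefutableGen` (per strategy).
WHAT THIS IS NOT: the double count itself (`DensityUpgradeWin`) is NOT proved here; separation NOT moved.
-/

namespace Summit.QuantumAdvantage.AdviceFreeQNC0

namespace AffBells26

open Finset Literature.Computability.QuantumComplexity Literature.Computability.QuantumComplexity.RingHLF
open AffBells23 Fib19

/-- **A mismatching move cube contains a lost odd input.** -/
theorem exists_lost_of_mismatch {N m : ℕ} (hN : 5 ≤ N) (hm : 2 ≤ m) (β : Fin N → Fin N → ZMod 3) (c : Fin N → ZMod 3)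
    {x : Fin N → Bool} {F O : Fin m → Finset (Fin N)} (hMS : MoveSystem x F O) (hMis : Mismatch β c x F O) :
    ∃ S : Finset (Fin m), IsOdd (xF x F S) ∧ ¬ RingHLF.Rel (xF x F S) (affBell β c (xF x F S)) := by
  by_contra hno
  push Not at hno
  apply hMis
  -- every cube point is odd and won: activeOnes + target ≡ 0 pointwise
  have hwin : ∀ S : Finset (Fin m),
      (activeOnes (xF x F S) (affBell β c (xF x F S)) +
        (N + zeros (kline (xF x F S)) + pairs2 (kline (xF x F S)))) % 2 = 0 := by
    intro S
    have hoddS : IsOdd (xF x F S) := (hMS.2.1 S).1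
    have := (targetFormula N (by omega) (xF x F S) hoddS (affBell β c (xF x F S))).mp (hno S hoddS)
    omega
  have hsum : (∑ S : Finset (Fin m), (activeOnes (xF x F S) (affBell β c (xF x F S)) +
      (N + zeros (kline (xF x F S)) + pairs2 (kline (xF x F S))))) % 2 = 0 := by
    rw [Finset.sum_nat_mod]
    simp [hwin]
  have h1 := cubeIdentityGen N m hN hm β c x F O hMS
  rw [Finset.sum_add_distrib] at hsum
  unfold cubeTargetSum
  omega

/-- Per strategy: a `CubeRefutableGen` matrix loses on some odd input for every offset vector (`N ≥ 5`). -/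
theorem exists_lost_of_cubeRefutableGen {N : ℕ} (hN : 5 ≤ N) (β : Fin N → Fin N → ZMod 3) (hβ : CubeRefutableGen β)
    (c : Fin N → ZMod 3) : ∃ x : Fin N → Bool, IsOdd x ∧ ¬ RingHLF.Rel x (affBell β c x) := by
  obtain ⟨m, x, F, O, hm, hMS, hO, hodd⟩ := hβ c
  have hT := cubeTargetGen N m hN hm x F O hMS hO
  have hMis : Mismatch β c x F O := by
    unfold Mismatch cubeTargetSum
    rw [hT]
    omega
  obtain ⟨S, hS, hlost⟩ := exists_lost_of_mismatch hN hm β c hMS hMis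
  exact ⟨xF x F S, hS, hlost⟩

end AffBells26

end Summit.QuantumAdvantage.AdviceFreeQNC0
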